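import Mathlib
import Summits.Ventures.PercRepro2.ReimerNonConstant
import Summits.Ventures.PercRepro2.ReimerCells

/-!
# BK for the uniform measure on the non-degenerate configurations (PercRepro2, mine-1)

`bk_nonconstant_uniform` (`MINE-1.md` Theorem 16.2): for increasing `A`, `B` on `𝒫(U)` and
`NC U S := S ≠ ∅ ∧ S ≠ U`,

  `#{S : A □ B at S ∧ NC S} · #{T : NC T} ≤ #{(S, T) : A S ∧ B T ∧ NC S ∧ NC T}`,

i.e. the uniform measure on `𝒫(U) \ {∅, U}` has the BK property for increasing events ("BK survives
conditioning on at least one open and one closed edge").  Proof: the cell decomposition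
`card_pairs_eq_sum_cells`; on a cell `(K, α)` the non-degeneracy of both `S = α ∪ γ` and
`T = α ∪ ((U \ K) \ γ)` holds automatically when `∅ ≠ α ≠ K` (then `reimer_increasing` on the sub-cube
applies) and otherwise says exactly that `γ` is non-constant on the sub-cube `I = U \ K`, where
Theorem 14.4 (`reimer_nonconstant`) applies.
-/

namespace Summit.Ventures.PercRepro2

namespace ReimerCube

variable {E : Type*} [DecidableEq E]

/-- Non-degenerate configurations: neither empty nor full. -/
def NC (U : Finset E) (S : Finset E) : Prop := S ≠ ∅ ∧ S ≠ U

/-- On a cell with `α ∈ {∅, K}`, non-degeneracy of both coordinates of the pair is non-constancy of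
`γ` on the sub-cube `I = U \ K`. -/
lemma nc_pair_iff {U K α γ : Finset E} (hK : K ⊆ U) (hα : α ⊆ K) (hγ : γ ⊆ U \ K)
    (hdeg : α = ∅ ∨ α = K) :
    (NC U (α ∪ γ) ∧ NC U (α ∪ ((U \ K) \ γ))) ↔ (γ ≠ ∅ ∧ γ ≠ U \ K) := by
  have hKI : K ∪ (U \ K) = U := Finset.union_sdiff_of_subset hK
  have hγI : ∀ x ∈ γ, x ∉ K := fun x hx => (Finset.mem_sdiff.mp (hγ hx)).2
  rcases hdeg with h0 | h0
  · -- α = ∅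
    subst h0
    simp only [Finset.empty_union, NC]
    constructor
    · rintro ⟨⟨h1, -⟩, ⟨h3, -⟩⟩
      refine ⟨h1, fun h => h3 ?_⟩
      rw [h, Finset.sdiff_self]
    · rintro ⟨h1, h2⟩
      have hne : ((U \ K) \ γ).Nonempty := by
        rw [Finset.nonempty_iff_ne_empty]
        intro h
        apply h2
        apply Finset.Subset.antisymm hγ
        intro z hz
        by_contra hzγ
        exact (Finset.eq_empty_iff_forall_notMem.mp h z) (Finset.mem_sdiff.mpr ⟨hz, hzγ⟩)
      refine ⟨⟨h1, ?_⟩, ⟨Finset.nonempty_iff_ne_empty.mp hne, ?_⟩⟩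
      · intro h
        apply h2
        apply Finset.Subset.antisymm hγ
        intro z hz
        rw [h]
        exact (Finset.mem_sdiff.mp hz).1
      · intro h
        apply h1
        apply Finset.eq_empty_iff_forall_notMem.mpr
        intro z hz
        have hzU : z ∈ U := (Finset.mem_sdiff.mp (hγ hz)).1
        have : z ∈ (U \ K) \ γ := by rw [h]; exact hzU
        exact (Finset.mem_sdiff.mp this).2 hz
  · -- α = K
    rw [h0]
    simp only [NC]
    constructor
    · rintro ⟨⟨-, h2⟩, ⟨-, h4⟩⟩
      constructor
      · intro h
        apply h4
        rw [h, Finset.sdiff_empty, hKI]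
      · intro h
        apply h2
        rw [h, hKI]
    · rintro ⟨h1, h2⟩
      obtain ⟨x, hx⟩ := Finset.nonempty_iff_ne_empty.mpr h1
      have hne : ((U \ K) \ γ).Nonempty := by
        rw [Finset.nonempty_iff_ne_empty]
        intro h
        apply h2
        apply Finset.Subset.antisymm hγ
        intro z hz
        by_contra hzγ
        exact (Finset.eq_empty_iff_forall_notMem.mp h z) (Finset.mem_sdiff.mpr ⟨hz, hzγ⟩)
      obtain ⟨y, hy⟩ := hne
      refine ⟨⟨Finset.ne_empty_of_mem (Finset.mem_union_right _ hx), ?_⟩,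
        ⟨Finset.ne_empty_of_mem (Finset.mem_union_right _ hy), ?_⟩⟩
      · intro h
        -- y ∈ U but y ∉ K ∪ γ
        have hyU : y ∈ U := (Finset.mem_sdiff.mp (Finset.mem_sdiff.mp hy).1).1
        have : y ∈ K ∪ γ := by rw [h]; exact hyU
        rcases Finset.mem_union.mp this with h' | h'
        · exact (Finset.mem_sdiff.mp (Finset.mem_sdiff.mp hy).1).2 h'
        · exact (Finset.mem_sdiff.mp hy).2 h'
      · intro h
        have hxU : x ∈ U := (Finset.mem_sdiff.mp (hγ hx)).1
        have : x ∈ K ∪ ((U \ K) \ γ) := by rw [h]; exact hxU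
        rcases Finset.mem_union.mp this with h' | h'
        · exact hγI x hx h'
        · exact (Finset.mem_sdiff.mp h').2 hx

open Classical in
/-- The cell inequality with the non-degeneracy constraint on both coordinates of the pair. -/
lemma cell_nonconstant (U K α : Finset E) (hK : K ⊆ U) (hα : α ⊆ K) (A B : Finset E → Prop)
    (hA : Incr A) (hB : Incr B) :
    ((U \ K).powerset.filter
        (fun γ => DOcc A B (α ∪ γ) ∧ NC U (α ∪ γ) ∧ NC U (α ∪ ((U \ K) \ γ)))).card
      ≤ ((U \ K).powerset.filter
        (fun γ => A (α ∪ γ) ∧ B (α ∪ ((U \ K) \ γ))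
          ∧ NC U (α ∪ γ) ∧ NC U (α ∪ ((U \ K) \ γ)))).card := by
  by_cases hmid : α ≠ ∅ ∧ α ≠ K
  · -- both constraints hold automatically on the cell
    have hnc : ∀ γ ∈ (U \ K).powerset, NC U (α ∪ γ) ∧ NC U (α ∪ ((U \ K) \ γ)) := by
      intro γ hγ
      rw [Finset.mem_powerset] at hγ
      obtain ⟨x, hx⟩ := Finset.nonempty_iff_ne_empty.mpr hmid.1
      obtain ⟨y, hyK, hyα⟩ :=
        Finset.exists_of_ssubset (Finset.ssubset_iff_subset_ne.mpr ⟨hα, hmid.2⟩)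
      have hyU : y ∈ U := hK hyK
      have hy1 : y ∉ α ∪ γ := by
        rw [Finset.mem_union, not_or]
        exact ⟨hyα, fun h => (Finset.mem_sdiff.mp (hγ h)).2 hyK⟩
      have hy2 : y ∉ α ∪ ((U \ K) \ γ) := by
        rw [Finset.mem_union, not_or]
        exact ⟨hyα, fun h => (Finset.mem_sdiff.mp (Finset.mem_sdiff.mp h).1).2 hyK⟩
      refine ⟨⟨?_, ?_⟩, ⟨?_, ?_⟩⟩
      · exact Finset.ne_empty_of_mem (Finset.mem_union_left _ hx)
      · intro h
        exact hy1 (by rw [h]; exact hyU)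
      · exact Finset.ne_empty_of_mem (Finset.mem_union_left _ hx)
      · intro h
        exact hy2 (by rw [h]; exact hyU)
    calc ((U \ K).powerset.filter
          (fun γ => DOcc A B (α ∪ γ) ∧ NC U (α ∪ γ) ∧ NC U (α ∪ ((U \ K) \ γ)))).card
        ≤ ((U \ K).powerset.filter (fun γ => DOcc (shift α A) (shift α B) γ)).card := by
          apply Finset.card_le_card
          intro γ hγ
          simp only [Finset.mem_filter] at hγ ⊢
          exact ⟨hγ.1, dOcc_shift hγ.2.1⟩
      _ ≤ ((U \ K).powerset.filter
          (fun γ => shift α A γ ∧ shift α B ((U \ K) \ γ))).card :=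
          reimer_increasing (U \ K) (shift α A) (shift α B) (incr_shift hA α) (incr_shift hB α)
      _ ≤ _ := by
          apply Finset.card_le_card
          intro γ hγ
          simp only [Finset.mem_filter] at hγ ⊢
          exact ⟨hγ.1, hγ.2.1, hγ.2.2, hnc γ hγ.1⟩
  · -- α ∈ {∅, K}: the constraints are non-constancy of γ on the sub-cube
    have hdeg : α = ∅ ∨ α = K := by
      by_cases h0 : α = ∅
      · exact Or.inl h0
      · right
        by_contra h1
        exact hmid ⟨h0, h1⟩
    calc ((U \ K).powerset.filter
          (fun γ => DOcc A B (α ∪ γ) ∧ NC U (α ∪ γ) ∧ NC U (α ∪ ((U \ K) \ γ)))).card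
        ≤ ((U \ K).powerset.filter (fun γ => DOcc (shift α A) (shift α B) γ
            ∧ ((γ ∩ (U \ K)).Nonempty ∧ γ ∩ (U \ K) ≠ U \ K))).card := by
          apply Finset.card_le_card
          intro γ hγ
          simp only [Finset.mem_filter, Finset.mem_powerset] at hγ ⊢
          have h := (nc_pair_iff hK hα hγ.1 hdeg).mp hγ.2.2
          rw [Finset.inter_eq_left.mpr hγ.1]
          exact ⟨hγ.1, dOcc_shift hγ.2.1, Finset.nonempty_iff_ne_empty.mpr h.1, h.2⟩
      _ ≤ ((U \ K).powerset.filter (fun γ => shift α A γ ∧ shift α B ((U \ K) \ γ)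
            ∧ ((γ ∩ (U \ K)).Nonempty ∧ γ ∩ (U \ K) ≠ U \ K))).card :=
          reimer_nonconstant (U \ K) (U \ K) (Finset.Subset.refl _) (shift α A) (shift α B)
            (incr_shift hA α) (incr_shift hB α)
      _ ≤ _ := by
          apply Finset.card_le_card
          intro γ hγ
          simp only [Finset.mem_filter, Finset.mem_powerset] at hγ ⊢
          rw [Finset.inter_eq_left.mpr hγ.1] at hγ
          have h := (nc_pair_iff hK hα hγ.1 hdeg).mpr ⟨Finset.nonempty_iff_ne_empty.mp hγ.2.2.2.1, hγ.2.2.2.2⟩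
          exact ⟨hγ.1, hγ.2.1, hγ.2.2.1, h⟩

open Classical in
/-- **BK for the uniform measure on the non-degenerate configurations (MINE-1 Theorem 16.2).**
For increasing `A`, `B` on `𝒫(U)`:
`#{S : A □ B at S ∧ NC S} · #{T : NC T} ≤ #{(S, T) : A S ∧ B T ∧ NC S ∧ NC T}`. -/
theorem bk_nonconstant_uniform (U : Finset E) (A B : Finset E → Prop) (hA : Incr A) (hB : Incr B) :
    (U.powerset.filter (fun S => DOcc A B S ∧ NC U S)).card * (U.powerset.filter (NC U)).card
      ≤ ((U.powerset ×ˢ U.powerset).filter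
          (fun p => A p.1 ∧ B p.2 ∧ NC U p.1 ∧ NC U p.2)).card := by
  have hL : (U.powerset.filter (fun S => DOcc A B S ∧ NC U S)).card
        * (U.powerset.filter (NC U)).card
      = ((U.powerset ×ˢ U.powerset).filter
          (fun p => DOcc A B p.1 ∧ NC U p.1 ∧ NC U p.2)).card := by
    rw [← Finset.card_product]
    congr 1
    ext p
    simp only [Finset.mem_filter, Finset.mem_product]
    tauto
  rw [hL]
  have h1 := card_pairs_eq_sum_cells U (fun S T => DOcc A B S ∧ NC U S ∧ NC U T)
  have h2 := card_pairs_eq_sum_cells U (fun S T => A S ∧ B T ∧ NC U S ∧ NC U T)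
  beta_reduce at h1 h2
  refine le_trans (le_of_eq h1) (le_trans ?_ (le_of_eq h2.symm))
  apply Finset.sum_le_sum
  intro K hK
  apply Finset.sum_le_sum
  intro α hα
  exact cell_nonconstant U K α (Finset.mem_powerset.mp hK) (Finset.mem_powerset.mp hα) A B hA hB

end ReimerCube

end Summit.Ventures.PercRepro2
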